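import Summits.BirchSwinnertonDyer.Rank1Residual.X11b.BDPRouteUpperGZRealShape
import HarnessLib

/-!
# Route `RamifiedHeegnerPair`, crux U₁ `LeafRankOneUpperAtThree` (stmt-BirchSwinnertonDyer-26022), line `partnerdescent` —
# `#Ш_an` from a REAL Gross–Zagier display with FREE period-degree constants (part 2a of the partner kernel)

HONEST FRAMING. Theorems only; helper file (`--supports stmt-BirchSwinnertonDyer-26022 --as helper`); no definition, no named
fact, no `sorry`; nothing booked, no item closed; CONDITIONAL on every displayed input; BSD is proved for no curve. Lead prover
bsd-line-rhp-p2 g55, 2026-08-30.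

WHY. On the (DEG)-orphan region R1 of the line of record the Heegner point of the leaf curve `E` is sourced from the Shimura-curve
parametrisation of its `3`-GOOD twist partner `V = E ⊗ χ₋₃` (Cai–Shu–Tian 2014, Thm. 1.1 ∕ 1.5 with the genus character `χ₋₃∘Nm` of
conductor `c = 3`: the constant `8π²(φ_V, φ_V)/(u²√|D·c²|)` carries `√(c²) = 3`, which cancels the `3` of
`covol(Λ_V) = 3·covol(Λ_E)` — the twist by `−3` of a curve of Kodaira type `I₀*` at `3`). The resulting REAL display for `E`
reads `degS · L′(E/K,1) = (2·covol(Λ_E)·dC/(cM²(w/2)²√|d_K|))·ĥ_K(P)` with the modular degree `dC` and Manin constant `cM` OF THE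
PARTNER's (optimal) datum, not of `E`'s. X11b's `exists_shaAn_padicVal_eq_of_shimuraGZReal` ∕ `gzShape₀_of_shimuraGZReal`
(b2b-bsdres, multr1-p2) use `Dt.modularDegree` and `Dt.c` only as a positive natural and a `p`-unit integer; this file is their
text VERBATIM with those two numbers made FREE parameters `(dC : ℕ) (cM : ℤ)`, `p ∤ cM`.

* `exists_shaAn_padicVal_eq_of_realDisplay` — `Ш(E)`, `Ш(E/K)` finite, `ord_p #Ш(E/K) = ord_p #Ш(E) + ord_p #Ш(E^{d_K})`, and
  `#Ш(E)_an = q` with `ord_p q + ord_p q_d + ord_p ∏c(E) + 2 ord_p #E^{d_K}(ℚ)_tors + ord_p degS = 2 ord_p[E(K):ℤP] + ord_p dC`.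
  (The (GZ-Sh₀) conjunct and the non-torsion corollary are the sequel `…LeafPartnerGZShape.lean`.)
-- adapted from Summits/BirchSwinnertonDyer/Rank1Residual/X11b/BDPRouteUpperGZReal.lean (verbatim, two constants freed)

References: [cite: CaiShuTian2014, Thm. 1.1 and Thm. 1.5] [cite: JetchevSkinnerWan2017, §7.4.2 (pp. 30–31)] [cite: Miller2011LMS, Def. 1.1]
[cite: ZagierCMB1985, §1, p. 374] [cite: SilvermanAEC2009, Exercise 10.16]. presearch: n/a (port of tree theorems; the cancelling
`3` is [corpus: arXiv:1408.1733 p. 2, Thm. 1.1: `u² √|D c²|`]).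
-/

noncomputable section

open scoped Classical

open WeierstrassCurve NumberField Literature.NumberTheory.EllipticCurves
  Literature.NumberTheory.EllipticCurves.ModularForms
  Literature.NumberTheory.EllipticCurves.Rank1Residual
  Literature.NumberTheory.EllipticCurves.KrizLi2019
  Literature.NumberTheory.QuadraticFields
  Summit.BirchSwinnertonDyer.Rank1Residual.X11b

-- D-0017: single-problem summit, so `Summit.BirchSwinnertonDyer.BirchSwinnertonDyer.…` repeats a namespace BY DESIGN.
set_option linter.dupNamespace false
set_option autoImplicit false

namespace Summit.BirchSwinnertonDyer.BirchSwinnertonDyer.Theorems.LeafPartnerGZShape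

/-! ## §1 `#Ш_an` and its valuation from a real display with free constants -/

/-- **The Gross–Zagier bookkeeping identity for `ord_p #Ш(E)_an` from a REAL display with FREE constants.** X11b's
`exists_shaAn_padicVal_eq_of_shimuraGZReal` VERBATIM with `Dt.modularDegree ↦ dC` (any natural; its positivity follows from the
display) and `Dt.c ↦ cM` (any integer with `p ∤ cM`); `Dt` still supplies the Néron lattice `Λ_E` of the globally minimal `W`
(`two_mul_covolume_div_sqrt_eq_bsdPeriod`). CONCLUSION: `Ш(E)`, `Ш(E/K)` finite,
`ord_p #Ш(E/K) = ord_p #Ш(E) + ord_p #Ш(E^{d_K})`, `#Ш(E)_an = q` with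
`ord_p q + ord_p q_d + ord_p ∏c(E) + 2 ord_p #E^{d_K}(ℚ)_tors + ord_p degS = 2 ord_p[E(K):ℤP] + ord_p dC`. CONDITIONAL on the
display; nothing booked. [cite: CaiShuTian2014, Thm. 1.1 and Thm. 1.5] [cite: JetchevSkinnerWan2017, §7.4.2 (pp. 30–31)]
[cite: Miller2011LMS, Def. 1.1] [cite: SilvermanAEC2009, Exercise 10.16] -/
theorem exists_shaAn_padicVal_eq_of_realDisplay
    (W : WeierstrassCurve ℚ) [W.IsElliptic] [W.IsGloballyMinimal] (p : ℕ) [Fact p.Prime]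
    (N : ℕ) [NeZero N] (K : Type) [Field K] [NumberField K]
    (Dt : ModularParametrizationData W N) (P : (W.baseChange K).toAffine.Point) (degS : ℕ)
    -- the FREE period-degree constants of the display (any natural `dC`, any `p`-unit integer `cM`)
    (dC : ℕ) (cM : ℤ)
    -- the published inputs (named facts of the tree)
    (hGZK : rank_eq_analyticRank_of_analyticRank_le_one) (hmod : hasEntireLFunction_rat)
    -- the data
    (hK : IsImaginaryQuadratic K) (hp2 : p ≠ 2) (hc : ¬ (p : ℤ) ∣ cM)
    (hμ : ¬ p ∣ Units.torsionOrder K) (hr : W.analyticRank = 1)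
    (hLt : (W.quadraticTwist (NumberField.discr K : ℚ)).entireLFunction 1 ≠ 0)
    (hdegS : 0 < degS)
    -- (GZ-Sh-ℝ): the explicit Gross–Zagier formula on `X_{N⁺,N⁻}` with Zagier's identity, REAL
    (hGZR : (degS : ℂ) * LDerivEK W K =
      ((2 * ZLattice.covolume Dt.L.lattice * (dC : ℝ) /
          ((cM : ℝ) ^ 2 * ((Units.torsionOrder K : ℝ) / 2) ^ 2 * √|(NumberField.discr K : ℝ)|) *
        P.canonicalHeight : ℝ) : ℂ))
    -- a globally minimal model of the quadratic twist by `d_K`, differing by a `p`-unit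
    (Wd : WeierstrassCurve ℚ) [Wd.IsElliptic] [Wd.IsGloballyMinimal] (Cd : VariableChange ℚ)
    (hWd : Cd • W.quadraticTwist (NumberField.discr K : ℚ) = Wd)
    (hu : padicValRat p (Cd.u : ℚ) = 0)
    -- the twist's algebraic central value (a datum)
    (qd : ℚ) (hqd : Wd.entireLFunction 1 / (Wd.realPeriodRat : ℂ) = (qd : ℂ)) :
    Finite W.sha ∧ Finite (W.baseChange K).sha ∧
      padicValNat p (W.baseChange K).shaOrder = padicValNat p W.shaOrder + padicValNat p Wd.shaOrder ∧
      ∃ q : ℚ, shaAn W = (q : ℂ) ∧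
        padicValRat p q + padicValRat p qd + padicValNat p W.tamagawaProduct +
            2 * padicValNat p Wd.torsionOrder + padicValNat p degS =
          2 * padicValNat p (AddSubgroup.zmultiples P).index + padicValNat p dC := by
  have hpp : p.Prime := Fact.out
  haveI hEK : (W.baseChange K).IsElliptic := isElliptic_baseChange' W K
  obtain ⟨h2, hKtc⟩ := hK
  haveI : IsTotallyComplex K := hKtc
  have hD0 : (NumberField.discr K : ℚ) ≠ 0 := by exact_mod_cast NumberField.discr_ne_zero K
  haveI hEt : (W.quadraticTwist (NumberField.discr K : ℚ)).IsElliptic :=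
    W.isElliptic_quadraticTwist hD0
  ---------------------------------------------------------------- `L`-values over `ℚ` and `K`
  have hL0 : W.entireLFunction 1 = 0 := entireLFunction_one_eq_zero_of_analyticRank_eq_one hr
  obtain ⟨hlead, hderiv⟩ := leadingLCoeff_eq_deriv_of_analyticRank_eq_one hr
  have hprod := lDerivEK_eq_deriv_mul W K hmod hL0
  have hLK : LDerivEK W K ≠ 0 := by
    rw [hprod]; exact mul_ne_zero hderiv hLt
  ---------------------------------------------------------------- analytic ranks and GZK over `ℚ`
  have hrt : (W.quadraticTwist (NumberField.discr K : ℚ)).analyticRank = 0 :=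
    ((W.quadraticTwist _).analyticRank_eq_zero_iff_holds (hmod _)).2 hLt
  have hrd : Wd.analyticRank = 0 := by rw [← hWd, analyticRank_smul, hrt]
  have hr1 : W.analyticRank ≤ 1 := le_of_eq hr
  obtain ⟨hrankW, hShaW⟩ := hGZK W hr1
  have hrQ : W.mordellWeilRank = 1 := by rw [hrankW, hr]
  have hrt1 : (W.quadraticTwist (NumberField.discr K : ℚ)).analyticRank ≤ 1 := by omega
  obtain ⟨hrankt, hShat⟩ := hGZK (W.quadraticTwist (NumberField.discr K : ℚ)) hrt1
  have hrkt : (W.quadraticTwist (NumberField.discr K : ℚ)).mordellWeilRank = 0 := by rw [hrankt, hrt]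
  have hrd1 : Wd.analyticRank ≤ 1 := by omega
  obtain ⟨hrankd, hShad⟩ := hGZK Wd hrd1
  have hrkd : Wd.mordellWeilRank = 0 := by rw [hrankd, hrd]
  haveI hfind : Finite Wd.toAffine.Point := Wd.mordellWeilRank_eq_zero_iff_holds.mp hrkd
  haveI hfinSd : Finite Wd.sha := hShad
  haveI hfinW : Finite W.sha := hShaW
  have htdeq : Wd.torsionOrder = Nat.card Wd.toAffine.Point := Wd.torsionOrder_eq_natCard_of_finite
  ---------------------------------------------------------------- rank and `Ш` over `K` by base change (no Heegner hypothesis)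
  have hrkK : (W.baseChange K).mordellWeilRank = 1 := by
    rw [mordellWeilRank_baseChange_quadratic_holds W K h2, hrQ, hrkt]
  have hShaK : (W.baseChange K).ShaFinite := shaFinite_baseChange_of_shaFinite W K h2 hShaW hShat
  haveI hfinK : Finite (W.baseChange K).sha := hShaK
  ---------------------------------------------------------------- the point is non-torsion
  have hdegSC : (degS : ℂ) ≠ 0 := by exact_mod_cast hdegS.ne'
  have hPinf : ¬ IsOfFinAddOrder P := by
    intro hfin
    have hh0 : P.canonicalHeight = 0 := (Affine.Point.canonicalHeight_eq_zero_iff_holds P).mpr hfin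
    have : (degS : ℂ) * LDerivEK W K = 0 := by rw [hGZR, hh0]; simp
    exact (mul_ne_zero hdegSC hLK) this
  ---------------------------------------------------------------- heights and index (Kriz–Li §2)
  obtain ⟨m, hm, hheight⟩ :=
    exists_mul_canonicalHeight_eq_index_sq_mul_regulator W K h2 hrkK hrQ P hPinf
  ---------------------------------------------------------------- the period
  have hper := two_mul_covolume_div_sqrt_eq_bsdPeriod W K Dt h2
  have hΩ := W.realPeriod_mul_realPeriod_quadraticTwist_eq_mul_bsdPeriod K h2
  have hΩd : Wd.realPeriodRat =
      |((Cd.u : ℚ) : ℝ)| * (W.quadraticTwist (NumberField.discr K : ℚ)).realPeriodRat := by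
    rw [← hWd]; exact realPeriodRat_smul_holds (W.quadraticTwist _) Cd
  have hLt' : (W.quadraticTwist (NumberField.discr K : ℚ)).entireLFunction = Wd.entireLFunction := by
    rw [← hWd, entireLFunction_smul]
  ---------------------------------------------------------------- the twist's `L`-value
  have hΩdpos : 0 < Wd.realPeriodRat := Wd.realPeriodRat_pos_holds
  have hΩdC : (Wd.realPeriodRat : ℂ) ≠ 0 := by exact_mod_cast hΩdpos.ne'
  have hLd : Wd.entireLFunction 1 = (((qd : ℝ) * Wd.realPeriodRat : ℝ) : ℂ) := by
    have := (div_eq_iff hΩdC).mp hqd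
    rw [this]; push_cast; ring
  have hLd1 : Wd.entireLFunction 1 ≠ 0 := by rw [← hLt']; exact hLt
  have hqd0 : qd ≠ 0 := by
    intro h0
    apply hLd1
    rw [hLd, h0]; simp
  ---------------------------------------------------------------- positivity of everything
  have hΩW : 0 < W.realPeriodRat := W.realPeriodRat_pos_holds
  have hΩt : 0 < (W.quadraticTwist (NumberField.discr K : ℚ)).realPeriodRat :=
    (W.quadraticTwist _).realPeriodRat_pos_holds
  have hR : 0 < W.regulator := W.regulator_pos'
  have hcW : 0 < W.tamagawaProduct := W.tamagawaProduct_pos_holds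
  have htW : 0 < W.torsionOrder := W.torsionOrder_pos_holds
  have htK : 0 < (W.baseChange K).torsionOrder := (W.baseChange K).torsionOrder_pos_holds
  have htd : 0 < Nat.card Wd.toAffine.Point := Nat.card_pos
  have hcM : (cM : ℚ) ≠ 0 := by
    have : cM ≠ 0 := by rintro h0; exact hc (h0 ▸ dvd_zero (p : ℤ))
    exact_mod_cast this
  have hw : 0 < Units.torsionOrder K := Units.torsionOrder_pos K
  have huu : (Cd.u : ℚ) ≠ 0 := Cd.u.ne_zero
  have hm0 : 0 < m := by rcases hm with rfl | rfl <;> norm_num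
  have hdegC0 : 0 < dC := by
    -- if the degree were `0` the display would give `L′(E/K,1) = 0`
    by_contra h0
    have h0' : dC = 0 := by omega
    have : (degS : ℂ) * LDerivEK W K = 0 := by rw [hGZR, h0']; simp
    exact (mul_ne_zero hdegSC hLK) this
  have hI0 : (AddSubgroup.zmultiples P).index ≠ 0 := by
    intro hI
    rw [hI] at hheight
    have h0 : (m : ℝ) * ((W.baseChange K).torsionOrder : ℝ) ^ 2 * P.canonicalHeight = 0 := by
      rw [hheight]; simp
    have hh0 : P.canonicalHeight = 0 := by
      rcases mul_eq_zero.mp h0 with h' | h'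
      · rcases mul_eq_zero.mp h' with h'' | h''
        · exact absurd (by exact_mod_cast h'' : m = 0) hm0.ne'
        · exact absurd (pow_eq_zero_iff two_ne_zero |>.mp h'') (by exact_mod_cast htK.ne')
      · exact h'
    exact hPinf ((Affine.Point.canonicalHeight_eq_zero_iff_holds P).mp hh0)
  set n := (W.baseChange ℝ).numRealComponents with hn_def
  have hn : n = 1 ∨ n = 2 := numRealComponents_eq_one_or W
  have hn0 : 0 < n := by rcases hn with h' | h' <;> omega
  ---------------------------------------------------------------- the rational number `q = #Ш_an`
  set I := (AddSubgroup.zmultiples P).index with hI_def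
  set q : ℚ := 8 * (I : ℚ) ^ 2 * (W.torsionOrder : ℚ) ^ 2 * (dC : ℚ) /
      ((n : ℚ) * (m : ℚ) * ((W.baseChange K).torsionOrder : ℚ) ^ 2 * (cM : ℚ) ^ 2 *
        (Units.torsionOrder K : ℚ) ^ 2 * qd * |(Cd.u : ℚ)| * (W.tamagawaProduct : ℚ) * (degS : ℚ))
    with hq_def
  ---------------------------------------------------------------- real abbreviations
  set ΩW := W.realPeriodRat with hΩW_def
  set Ωt := (W.quadraticTwist (NumberField.discr K : ℚ)).realPeriodRat with hΩt_def
  set B := (W.baseChange K).bsdPeriod with hB_def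
  set R := W.regulator with hR_def
  set hh := P.canonicalHeight with hhh_def
  set tK := (W.baseChange K).torsionOrder with htK_def
  set tW := W.torsionOrder with htW_def
  set td := Nat.card Wd.toAffine.Point with htd_def
  set cW := W.tamagawaProduct with hcW_def
  set w := Units.torsionOrder K with hw_def
  set u := (Cd.u : ℚ) with hu_def
  have hΩW' : ΩW = (W.baseChange ℝ).realPeriod := rfl
  have hΩt' : Ωt = ((W.quadraticTwist (NumberField.discr K : ℚ)).baseChange ℝ).realPeriod := rfl
  rw [← hΩW', ← hΩt'] at hΩ
  -- `B = ΩW Ωt / n`, `ĥ = 2 I² R / (m tK²)`, the Gross–Zagier constant `= 4 B / (c² w²)`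
  have hBeq : B = ΩW * Ωt / n := by
    rw [hΩ]; field_simp
  have hheq : hh = 2 * (I : ℝ) ^ 2 * R / ((m : ℝ) * (tK : ℝ) ^ 2) := by
    rw [← hheight]; field_simp
  have hGZc : 2 * ZLattice.covolume Dt.L.lattice * (dC : ℝ) /
        ((cM : ℝ) ^ 2 * ((w : ℝ) / 2) ^ 2 * √|(NumberField.discr K : ℝ)|) =
      4 * B * (dC : ℝ) / ((cM : ℝ) ^ 2 * (w : ℝ) ^ 2) := by
    rw [← hper]; field_simp; ring
  -- the `L`-values as real numbers
  have hLdr : Wd.entireLFunction 1 = (((qd : ℝ) * (|(u : ℝ)| * Ωt) : ℝ) : ℂ) := by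
    rw [hLd, hΩd]
  have hLdne : ((qd : ℝ) * (|(u : ℝ)| * Ωt) : ℝ) ≠ 0 := by
    have hu' : |(u : ℝ)| ≠ 0 := abs_ne_zero.mpr (by exact_mod_cast huu)
    have hqd' : (qd : ℝ) ≠ 0 := by exact_mod_cast hqd0
    exact mul_ne_zero hqd' (mul_ne_zero hu' hΩt.ne')
  have hdegSR : (degS : ℝ) ≠ 0 := by exact_mod_cast hdegS.ne'
  set X : ℝ := (4 * B * (dC : ℝ) / ((cM : ℝ) ^ 2 * (w : ℝ) ^ 2) * hh) /
      ((degS : ℝ) * ((qd : ℝ) * (|(u : ℝ)| * Ωt))) with hX_def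
  have hL1 : deriv W.entireLFunction 1 = ((X : ℝ) : ℂ) := by
    have hne : ((((degS : ℝ) * ((qd : ℝ) * (|(u : ℝ)| * Ωt)) : ℝ)) : ℂ) ≠ 0 := by
      exact_mod_cast mul_ne_zero hdegSR hLdne
    have key : deriv W.entireLFunction 1 * ((((degS : ℝ) * ((qd : ℝ) * (|(u : ℝ)| * Ωt)) : ℝ)) : ℂ) =
        ((4 * B * (dC : ℝ) / ((cM : ℝ) ^ 2 * (w : ℝ) ^ 2) * hh : ℝ) : ℂ) := by
      rw [← hGZc]
      have hdegS' : ((degS : ℝ) : ℂ) = (degS : ℂ) := by norm_cast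
      calc deriv W.entireLFunction 1 * ((((degS : ℝ) * ((qd : ℝ) * (|(u : ℝ)| * Ωt)) : ℝ)) : ℂ)
          = (degS : ℂ) * (deriv W.entireLFunction 1 * ((((qd : ℝ) * (|(u : ℝ)| * Ωt)) : ℝ) : ℂ)) := by
            push_cast; ring
        _ = (degS : ℂ) * LDerivEK W K := by rw [hprod, hLt', hLdr]
        _ = _ := hGZR
    rw [hX_def, Complex.ofReal_div, ← key, mul_div_cancel_right₀ _ hne]
  have hshaAnR : shaAn W = ((X * (tW : ℝ) ^ 2 / (ΩW * (cW : ℝ) * R) : ℝ) : ℂ) := by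
    rw [shaAn_def, hlead, hL1]
    push_cast
    rfl
  have hXq : X * (tW : ℝ) ^ 2 / (ΩW * (cW : ℝ) * R) = (q : ℝ) := by
    have hn' : (n : ℝ) ≠ 0 := by exact_mod_cast hn0.ne'
    have hm' : (m : ℝ) ≠ 0 := by exact_mod_cast hm0.ne'
    have htK' : (tK : ℝ) ≠ 0 := by exact_mod_cast htK.ne'
    have htW' : (tW : ℝ) ≠ 0 := by exact_mod_cast htW.ne'
    have hcW' : (cW : ℝ) ≠ 0 := by exact_mod_cast hcW.ne'
    have hcM' : (cM : ℝ) ≠ 0 := by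
      exact_mod_cast (show cM ≠ 0 by rintro h0; exact hc (h0 ▸ dvd_zero (p : ℤ)))
    have hw' : (w : ℝ) ≠ 0 := by exact_mod_cast hw.ne'
    have hu' : |(u : ℝ)| ≠ 0 := abs_ne_zero.mpr (by exact_mod_cast huu)
    have hI' : (I : ℝ) ≠ 0 := by exact_mod_cast hI0
    have hqd' : (qd : ℝ) ≠ 0 := by exact_mod_cast hqd0
    have hdC' : (dC : ℝ) ≠ 0 := by exact_mod_cast hdegC0.ne'
    rw [hX_def, hheq, hBeq, hq_def]
    push_cast
    field_simp
    ring
  have hshaAn : shaAn W = (q : ℂ) := by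
    rw [hshaAnR, hXq]; exact Complex.ofReal_ratCast q
  ---------------------------------------------------------------- `p`-adic valuations
  -- torsion: `v_p(tK) = v_p(tW) + v_p(td)`
  obtain ⟨θ, c, hθ, hcθ⟩ := Quadratic.exists_sq_eq_algebraMap (F := ℚ) (K := K) h2
  obtain ⟨qq, hqq, hdq⟩ := NumberField.exists_discr_eq_mul_sq h2 hθ hcθ
  have htors : padicValNat p tK = padicValNat p tW + padicValNat p td :=
    padicValNat_torsionOrder_baseChange_quadratic W K h2 hθ hcθ hqq hdq ⟨Cd, hWd⟩ p hp2
  -- `Ш`: `v_p(S_K) = v_p(S_W) + v_p(S_d)`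
  have hsha : padicValNat p (W.baseChange K).shaOrder =
      padicValNat p W.shaOrder + padicValNat p Wd.shaOrder := by
    have hcard := card_primaryComponent_sha_baseChange_quadratic_of_odd_of_finite W K h2 Wd
      ⟨Cd, hWd⟩ (W.baseChange K) ⟨1, one_smul _ _⟩ p hp2
    rw [WeierstrassCurve.shaOrder, WeierstrassCurve.shaOrder, WeierstrassCurve.shaOrder,
      ← (Nat.pow_right_injective hpp.two_le).eq_iff, pow_add,
      ← natCard_primaryComponent_eq_pow_padicValNat p, ← natCard_primaryComponent_eq_pow_padicValNat p,
      ← natCard_primaryComponent_eq_pow_padicValNat p]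
    exact hcard
  -- valuation of `q`
  have hI' : (I : ℚ) ≠ 0 := by exact_mod_cast hI0
  have htW' : (tW : ℚ) ≠ 0 := by exact_mod_cast htW.ne'
  have htK' : (tK : ℚ) ≠ 0 := by exact_mod_cast htK.ne'
  have hn' : (n : ℚ) ≠ 0 := by exact_mod_cast hn0.ne'
  have hm' : (m : ℚ) ≠ 0 := by exact_mod_cast hm0.ne'
  have hcW' : (cW : ℚ) ≠ 0 := by exact_mod_cast hcW.ne'
  have hw' : (w : ℚ) ≠ 0 := by exact_mod_cast hw.ne'
  have hua : |u| ≠ 0 := abs_ne_zero.mpr huu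
  have hdC' : (dC : ℚ) ≠ 0 := by exact_mod_cast hdegC0.ne'
  have hdS' : (degS : ℚ) ≠ 0 := by exact_mod_cast hdegS.ne'
  have h8 : padicValRat p (8 : ℚ) = 0 := by
    rw [show (8 : ℚ) = ((8 : ℕ) : ℚ) by norm_num, padicValRat.of_nat]
    have : ¬ p ∣ 8 := by
      intro h
      have h' : p ∣ 2 ^ 3 := by simpa using h
      exact hp2 ((Nat.prime_dvd_prime_iff_eq hpp Nat.prime_two).mp (hpp.dvd_of_dvd_pow h'))
    simp [padicValNat.eq_zero_of_not_dvd this]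
  have hvn : padicValRat p (n : ℚ) = 0 := by
    rw [padicValRat.of_nat]
    have : ¬ p ∣ n := by
      rcases hn with h' | h'
      · rw [h']; exact hpp.one_lt.ne' ∘ Nat.dvd_one.mp
      · rw [h']; intro hd; exact hp2 ((Nat.prime_dvd_prime_iff_eq hpp Nat.prime_two).mp hd)
    simp [padicValNat.eq_zero_of_not_dvd this]
  have hvm : padicValRat p (m : ℚ) = 0 := by
    rw [padicValRat.of_nat]
    have : ¬ p ∣ m := by
      rcases hm with rfl | rfl
      · exact hpp.one_lt.ne' ∘ Nat.dvd_one.mp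
      · intro hd
        have h' : p ∣ 2 ^ 2 := by simpa using hd
        exact hp2 ((Nat.prime_dvd_prime_iff_eq hpp Nat.prime_two).mp (hpp.dvd_of_dvd_pow h'))
    simp [padicValNat.eq_zero_of_not_dvd this]
  have hvc : padicValRat p (cM : ℚ) = 0 := by
    rw [padicValRat.of_int, padicValInt.eq_zero_of_not_dvd hc]; rfl
  have hvw : padicValRat p (w : ℚ) = 0 := by
    rw [padicValRat.of_nat, padicValNat.eq_zero_of_not_dvd hμ]; rfl
  have hvu : padicValRat p |u| = 0 := by
    rcases abs_choice u with h' | h'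
    · rw [h']; exact hu
    · rw [h', padicValRat.neg]; exact hu
  have hvtd : padicValNat p Wd.torsionOrder = padicValNat p td := by rw [htdeq]
  have hval : padicValRat p q + padicValRat p qd + padicValNat p cW +
      2 * padicValNat p Wd.torsionOrder + padicValNat p degS =
      2 * padicValNat p I + padicValNat p dC := by
    -- nonvanishing of the partial products
    have hA1 : (8 : ℚ) * (I : ℚ) ^ 2 ≠ 0 := mul_ne_zero (by norm_num) (pow_ne_zero _ hI')
    have hA2 : (8 : ℚ) * (I : ℚ) ^ 2 * (tW : ℚ) ^ 2 ≠ 0 := mul_ne_zero hA1 (pow_ne_zero _ htW')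
    have hA3 : (8 : ℚ) * (I : ℚ) ^ 2 * (tW : ℚ) ^ 2 * (dC : ℚ) ≠ 0 := mul_ne_zero hA2 hdC'
    have hD1 : (n : ℚ) * (m : ℚ) ≠ 0 := mul_ne_zero hn' hm'
    have hD2 : (n : ℚ) * (m : ℚ) * (tK : ℚ) ^ 2 ≠ 0 := mul_ne_zero hD1 (pow_ne_zero _ htK')
    have hD3 : (n : ℚ) * (m : ℚ) * (tK : ℚ) ^ 2 * (cM : ℚ) ^ 2 ≠ 0 :=
      mul_ne_zero hD2 (pow_ne_zero _ hcM)
    have hD4 : (n : ℚ) * (m : ℚ) * (tK : ℚ) ^ 2 * (cM : ℚ) ^ 2 * (w : ℚ) ^ 2 ≠ 0 :=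
      mul_ne_zero hD3 (pow_ne_zero _ hw')
    have hD5 : (n : ℚ) * (m : ℚ) * (tK : ℚ) ^ 2 * (cM : ℚ) ^ 2 * (w : ℚ) ^ 2 * qd ≠ 0 :=
      mul_ne_zero hD4 hqd0
    have hD6 : (n : ℚ) * (m : ℚ) * (tK : ℚ) ^ 2 * (cM : ℚ) ^ 2 * (w : ℚ) ^ 2 * qd * |u| ≠ 0 :=
      mul_ne_zero hD5 hua
    have hD7 : (n : ℚ) * (m : ℚ) * (tK : ℚ) ^ 2 * (cM : ℚ) ^ 2 * (w : ℚ) ^ 2 * qd * |u| *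
        (cW : ℚ) ≠ 0 := mul_ne_zero hD6 hcW'
    have hD8 : (n : ℚ) * (m : ℚ) * (tK : ℚ) ^ 2 * (cM : ℚ) ^ 2 * (w : ℚ) ^ 2 * qd * |u| *
        (cW : ℚ) * (degS : ℚ) ≠ 0 := mul_ne_zero hD7 hdS'
    have hnum : padicValRat p ((8 : ℚ) * (I : ℚ) ^ 2 * (tW : ℚ) ^ 2 * (dC : ℚ)) =
        2 * padicValNat p I + 2 * padicValNat p tW + padicValNat p dC := by
      rw [padicValRat.mul hA2 hdC', padicValRat.mul hA1 (pow_ne_zero _ htW'),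
        padicValRat.mul (by norm_num) (pow_ne_zero _ hI'),
        padicValRat.pow, padicValRat.pow, h8, padicValRat.of_nat, padicValRat.of_nat,
        padicValRat.of_nat]
      push_cast; ring
    have hden : padicValRat p ((n : ℚ) * (m : ℚ) * (tK : ℚ) ^ 2 * (cM : ℚ) ^ 2 * (w : ℚ) ^ 2 *
        qd * |u| * (cW : ℚ) * (degS : ℚ)) =
        2 * padicValNat p tK + padicValRat p qd + padicValNat p cW + padicValNat p degS := by
      rw [padicValRat.mul hD7 hdS', padicValRat.mul hD6 hcW', padicValRat.mul hD5 hua,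
        padicValRat.mul hD4 hqd0,
        padicValRat.mul hD3 (pow_ne_zero _ hw'), padicValRat.mul hD2 (pow_ne_zero _ hcM),
        padicValRat.mul hD1 (pow_ne_zero _ htK'), padicValRat.mul hn' hm', padicValRat.pow,
        padicValRat.pow, padicValRat.pow, hvn, hvm, hvc, hvw, hvu, padicValRat.of_nat,
        padicValRat.of_nat, padicValRat.of_nat]
      push_cast; ring
    rw [hq_def, padicValRat.div hA3 hD8, hnum, hden, hvtd]
    have e2 : (padicValNat p tK : ℤ) = padicValNat p tW + padicValNat p td := by exact_mod_cast htors
    omega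
  exact ⟨hfinW, hfinK, hsha, q, hshaAn, hval⟩


end Summit.BirchSwinnertonDyer.BirchSwinnertonDyer.Theorems.LeafPartnerGZShape

end
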